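import Mathlib.Algebra.Ring.BooleanRing
import Summits.QuantumAdvantage.QuantumAdvantage.Theorems.CubicForrelationNearExactIsExactIsolationSmallN
import Summits.QuantumAdvantage.QuantumAdvantage.Theorems.NearExactIsExact.Negative.MmPairFixedPoints
import Summits.QuantumAdvantage.QuantumAdvantage.Theorems.NearExactIsExact.Negative.F8ChainTwelve
import Summits.QuantumAdvantage.QuantumAdvantage.Theorems.NearExactIsExact.Negative.ProductFourteen
import Summits.QuantumAdvantage.QuantumAdvantage.Theorems.NearExactIsExact.Negative.NoCaseATwelve
import Summits.QuantumAdvantage.QuantumAdvantage.Theorems.NearExactIsExact.Negative.FifteenSixteenths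

/-!
# Crux `CubicForrelation.NearExactIsExact` (stmt-QuantumAdvantage-14043): the certified `θ_n` LADDER for `n = 8 … 16`,
  every entry kernel-checked with the standard axioms

Block-2b certificate seat `b2b-cforr-cert` (seat 3, 2026-08-19).  HONEST FRAMING: the value here is a table of DECIDABLE
VERDICTS about finite slices of the crux `NearExactIsExact` — NOT summit progress (the crux asks for ONE `θ < 1` uniform in
`n`; nothing here bears on that beyond `θ ≥ 15/16`).

For even `n` let `θ_n` denote the least `θ` such that every pair of cubic Boolean functions `f, g : 𝔽₂ⁿ → 𝔽₂` with
`Φ(f,g) > θ` is exact (`Φ(f,g) = 1`); equivalently `θ_n` = the largest forrelation value `< 1` of a cubic pair on `n` bits.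
What the tree proves, per `n` (this file packages each line as ONE theorem at the literal type `Fin n`):

| `n`  | isolation proved above | non-exact value attained | verdict (this file)                         |
|------|------------------------|--------------------------|---------------------------------------------|
| `8`  | `7/8`  (`isolation_eight`)          | `13/16` (`𝔽₄`-pencil pair)   | `theta_eight_bounds`:    `θ₈ ∈ [13/16, 7/8]`   |
| `10` | `7/8`  (`isolation_ten_78`)         | `7/8`  (`T`-family)          | `theta_ten_isLeast` (…TenThetaExact.lean): `θ₁₀ = 7/8` |
| `12` | `15/16` (`isolation_twelve_15_16`)  | `57/64` (`𝔽₈` chain)         | `theta_twelve_bounds`:   `θ₁₂ ∈ [57/64, 15/16]` |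
| `14` | `31/32` (`isolation_fourteen`)      | `57/64` (chain × bent pair)  | `theta_fourteen_bounds`: `θ₁₄ ∈ [57/64, 31/32]` |
| `16` | `63/64` (`isolation_sixteen`)       | `15/16` (`Negative/FifteenSixteenths`) | `theta_sixteen_bounds`: `θ₁₆ ∈ [15/16, 63/64]` |

So `7/8` is the sharp constant at `n = 10` only; at `n = 16` the value `15/16 < 1` occurs, hence any global constant of the
crux is `≥ 15/16` (`Negative.nearExactIsExact_iff_ge`).  The windows at `n = 12, 14, 16` are OPEN.

STATUS UPDATE (2026-08-19, later seats; the theorems of THIS file are unchanged and remain true but two rows are superseded):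
* `n = 8`: DECIDED — `θ₈ = 13/16` exactly: `isolation_eight_1316` / `theta_eight_isLeast`
  (`…EightThirteenSixteenths.lean`, certificate seat gen 2) improve the upper half `7/8` of `theta_eight_bounds` to `13/16`.
* `n = 16`: `θ₁₆ ∈ [15/16, 31/32]` — `isolation_sixteen_31_32` / `theta_sixteen_bounds_31_32`
  (`…SixteenThirtyOneThirtySeconds.lean`, certificate seat gen 3) improve the upper half `63/64` of `theta_sixteen_bounds` to
  `31/32`; the window `(15/16, 31/32]` remains open.
* `n = 18` (new row): `θ₁₈ ∈ [15/16, 63/64]` — `isolation_eighteen_63_64` / `theta_eighteen_bounds`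
  (`…EighteenSixtyThreeSixtyFourths.lean`, certificate seat gen 3; the tree had only `1 − 2⁻¹⁰` for `n = 18`, `isolation_window_le_28`).
* `n = 14`: `θ₁₄ ∈ [57/64, 31/32)` — HALF-OPEN: the boundary value `31/32` is NOT attained, `isolation_fourteen_closed`
  (`Φ ≥ 31/32 ⇒ Φ = 1` for cubic pairs on 14 bits) / `theta_fourteen_halfopen` (`…FourteenBoundary.lean`, certificate seat gen 4;
  the first TWO-SIDED (partner-using) rung: `…FourteenLevelSix.lean`, `…FourteenTypeO.lean`, general flat sums `…FlatSumsGeneral.lean`).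
* `n = 20` (new row): `θ₂₀ ∈ [15/16, 127/128]`, and for EVERY even `n ≥ 6`: `θ_n ≤ 1 − 2^{−⌊n/3⌋−1}` (`isolation_rate`), `θ_n`
  non-decreasing in `n` (`theta_mono`), `θ_n ≥ 15/16` for `n ≥ 16` (`…LadderEnvelope.lean`, certificate seat gen 4).  At `n = 16` the
  boundary configuration "type O" is excluded two-sidedly (`st_typeO_sixteen_lt`, `…SixteenTypeO.lean`).
* `n = 16` (2026-08-19, gen 6): `θ₁₆ ∈ [15/16, 31/32)` — HALF-OPEN: the boundary value `31/32` is NOT attained on 16 bits,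
  `isolation_sixteen_closed` (`Φ ≥ 31/32 ⇒ Φ = 1` for cubic pairs on 16 bits) / `theta_sixteen_halfopen` (`…SixteenBoundary.lean`,
  certificate seat gen 6; level 7 `…SixteenLevelSeven.lean`, level 8 `…SixteenLevelEight.lean`, split configurations
  `…SixteenSplitA/B/C.lean`, engine `…FlatL1.lean`: a sign pattern that is quadratic of rank `≤ 2` along a flat has few large frequencies).
  The window `(15/16, 31/32)` remains open.
* `n = 18, 20` (2026-08-20, gen 6): `θ₁₈ ∈ [15/16, 63/64)` (`isolation_eighteen_closed` / `theta_eighteen_halfopen`, `…EighteenBoundary.lean`)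
  and `θ₂₀ ∈ [15/16, 127/128)` (`isolation_twenty_closed` / `theta_twenty_halfopen`, `…TwentyBoundary.lean`); moreover for EVERY
  `n ≡ 2 (mod 6)`, `n ≥ 14`: `Φ ≥ 1 − 2^{−⌊n/3⌋−1} ⇒ Φ = 1` (`isolation_rate_closed_two_mod_six`, `…TwoModSixBoundary.lean`) — the
  boundary of the uniform rate is never attained on that residue class.  Structured class (gen 6, `…MmPairGap.lean`): every two-sided
  Maiorana–McFarland pair with quadratic maps and cubic offsets has `Φ = 1 ∨ Φ ≤ 31/32` at every `n` (`mg_mmPair_isolation`), and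
  `|Φ| ≤ 15/16` unless the maps are mutually inverse (`mg_mmPair_gap`).
* all residue classes (2026-08-20, gen 6, final): the boundary of the uniform rate is NEVER attained — for EVERY even `n ≥ 6`,
  `Φ ≥ 1 − 2^{−⌊n/3⌋−1} ⇒ Φ = 1` (`isolation_rate_closed_all` / `theta_lt_rate_all`, `…SixBoundary.lean`, assembling
  `isolation_rate_closed_zero_mod_six` (`…ZeroModSixBoundary.lean`, `n ≥ 12`), `isolation_rate_closed_two_mod_six`,
  `isolation_rate_closed_four_mod_six` (`…FourModSixBoundary.lean`, `n ≥ 16`), `isolation_rate_closed` (`…RateStrict.lean`, even `n ≥ 8`)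
  and the new row `θ₆ < 7/8` (`isolation_six_closed`, residual duality `τ̂_g = −2^m·τ_f`)).
* SECOND dyadic boundary (2026-08-20, gen 8): for every `n ≥ 16` with `n ≡ 0` or `n ≡ 4 (mod 6)`, `Φ ≥ 1 − 2^{−⌊n/3⌋} ⇒ Φ = 1`
  (`isolation_closed_sharp_zero_or_four_mod_six` / `theta_lt_sharp_zero_or_four_mod_six`, `…FourModSixSecondBoundary.lean`) — this
  DOUBLES the excluded window of the uniform rate on those two classes.  Parts: `n ≡ 0 (mod 6)`, `n ≥ 18`:
  `isolation_closed_zero_mod_six_sharp` / `theta_halfopen_zero_mod_six_sharp` (`…ZeroModSixSecondBoundary.lean`; chain `…ZeroModSixDigits`,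
  `…ZeroModSixSecondTypeO`, `…ZeroModSixSecondLevelOne`, `…ZeroModSixSecondLevelTwo` — the `n = 18` analysis in general `r`; `n = 12`
  (`r = 2`) fails only at the type-O step, `Negative/CapTightTwelve.lean`, so `θ₁₂ < 15/16` stays open); `n ≡ 4 (mod 6)`, `n ≥ 22`:
  `isolation_closed_four_mod_six_sharp` / `theta_halfopen_four_mod_six_sharp` (`…FourModSixSecondBoundary.lean`; chain `…FourModSixDigits`,
  `…FourModSixResidual`, `…FourModSixSecondTypeO`, `…FourModSixSecondLevelThree`, `…FourModSixSecondLevelFour`, `…FourModSixSecondSplitBudget`,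
  `…FourModSixSecondSplitA/B/C` — the twelve-file `n = 16` analysis in general `r`); `n = 16` is `isolation_sixteen_closed`.  New explicit
  rows: `θ₂₂ ∈ [15/16, 127/128)` (`isolation_twentytwo_closed`, `theta_twentytwo_halfopen`), `θ₂₄ ∈ [15/16, 255/256)`
  (`isolation_twentyfour_closed`, `theta_twentyfour_halfopen`), `θ₂₈ < 511/512` (`isolation_twentyeight_closed`), `θ₃₀ < 1023/1024`
  (`isolation_thirty_closed`).  For `n ≡ 2 (mod 6)` only the rate is known (the type-O digit `d₁` is quadratic there); at `n = 10` the value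
  `1 − 2^{−⌊n/3⌋} = 7/8` IS attained.
Current certified ladder: `θ₆ < 7/8`, `θ₈ = 13/16`, `θ₁₀ = 7/8`, `θ₁₂ ∈ [57/64, 15/16]`, `θ₁₄ ∈ [57/64, 31/32)`, `θ₁₆ ∈ [15/16, 31/32)`,
`θ₁₈ ∈ [15/16, 63/64)`, `θ₂₀ ∈ [15/16, 127/128)`, `θ₂₂ ∈ [15/16, 127/128)`, `θ₂₄ ∈ [15/16, 255/256)`, `θ₂₈ < 511/512`, `θ₃₀ < 1023/1024`;
uniformly `θ_n < 1 − 2^{−⌊n/3⌋−1}` for all even `n ≥ 6` and `θ_n < 1 − 2^{−⌊n/3⌋}` for all `n ≥ 16` with `n ≢ 2 (mod 6)`.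

AXIOMS.  The upper halves are the landed tower theorems (standard axioms).  The lower halves need the exact values of the
witnesses; for `n = 8, 12, 14` the tree had these only by `native_decide` (`forrelation_f8_g8`, `forrelation_fC_gC`,
`forrelation_f14_g14`, axiom `Lean.ofReduceBool`).  Here they are re-derived STRUCTURALLY (`tl8/tl12/tl14_forrelation_eq_card`):
each witness pair is, after a coordinate permutation (`forrelation_comp_perm`), a TWO-SIDED Maiorana–McFarland pair
`(-1)^{g(y′‖y″)} = (-1)^{y′·π(y″)}`, `(-1)^{f(x′‖x″)} = (-1)^{x″·τ(x′)}` with explicit quadratic `π, τ`, so the landed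
fixed-point formula `forrelation_mmPair` gives `Φ = #Fix(τ ∘ π)/2^m`, and `τ ∘ π ⊕ id` is supported on a punctured flat:
`Φ = 13/16, 57/64, 114/128` as counts `16 − 3`, `64 − 7`, `128 − 14` (kernel `decide`).  The `n = 16` value `15/16` was already
structural (`Negative.forrelation_f16_g16`).  Every declaration below has axioms `propext, Classical.choice, Quot.sound`.

References: S. Aaronson, A. Ambainis, *Forrelation*, SIAM J. Comput. 47 (2018) §1.1.1; C. Carlet, *Boolean Functions for
Cryptography and Coding Theory* (CUP 2021) §6.1 (Maiorana–McFarland class and duals); R. L. McFarland, JCTA 15 (1973).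
Everything here is proved from the tree.
-/

set_option linter.dupNamespace false -- D-0017: single-problem summit ⇒ `QuantumAdvantage.QuantumAdvantage` by design

noncomputable section

namespace Summit.QuantumAdvantage.QuantumAdvantage.Theorems.CubicForrelation.NearExactIsExact

open Finset
open Literature.Computability.QuantumComplexity
open Summit.QuantumAdvantage.QuantumAdvantage.Theorems.NearExactIsExact.Negative
  (f16 g16 isDegLeFun_f16 isDegLeFun_g16 forrelation_f16_g16)
open Summit.QuantumAdvantage.QuantumAdvantage.Theorems.NearExactIsExact.Negative.SmallCases
  (f8 g8 isDegLeFun_f8 isDegLeFun_g8)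
open Summit.QuantumAdvantage.QuantumAdvantage.Theorems.NearExactIsExact.Negative.F8Chain
  (fC gC isDegLeFun_fC isDegLeFun_gC)
open Summit.QuantumAdvantage.QuantumAdvantage.Theorems.NearExactIsExact.Negative.ProductFourteen
  (f14 g14 isDegLeFun_f14 isDegLeFun_g14)
open Summit.QuantumAdvantage.QuantumAdvantage.Theorems.NearExactIsExact.Negative.TypeOTwelve
  (isolation_twelve_15_16)
open Summit.QuantumAdvantage.QuantumAdvantage.Theorems.NearExactIsExact.Negative.MmPairFixedPoints
  (forrelation_mmPair)

/-! ### Tools: permutation invariance of `Φ`, inner products as twists -/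

/-- **Forrelation is invariant under a simultaneous permutation of the coordinates** of both arguments:
`Φ(f ∘ P_σ, g ∘ P_σ) = Φ(f, g)` (`(-1)^{x·y}` is permutation invariant; reindex both sums). [folklore] -/
theorem forrelation_comp_perm {n : ℕ} (σ : Equiv.Perm (Fin n)) (f g : (Fin n → Bool) → Bool) :
    forrelation (fun x => f (x ∘ σ)) (fun y => g (y ∘ σ)) = forrelation f g := by
  unfold forrelation
  congr 1
  set e : (Fin n → Bool) ≃ (Fin n → Bool) := Equiv.arrowCongr σ.symm (Equiv.refl Bool) with he_def
  have he : ∀ x : Fin n → Bool, e x = x ∘ σ := fun x => by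
    funext i; simp [he_def, Equiv.arrowCongr_apply]
  have htw : ∀ x y : Fin n → Bool, twist (x ∘ σ) (y ∘ σ) = twist x y := fun x y => by
    unfold twist
    exact Equiv.prod_comp σ (fun l => if (x l && y l) then (-1 : ℝ) else 1)
  calc ∑ x, ∑ y, signOf (f (x ∘ σ)) * twist x y * signOf (g (y ∘ σ))
      = ∑ x, ∑ y, signOf (f (e x)) * twist (e x) (e y) * signOf (g (e y)) := by
        simp only [he, htw]
    _ = ∑ x, ∑ y, signOf (f x) * twist x (e y) * signOf (g (e y)) :=
        Equiv.sum_comp e (fun x => ∑ y, signOf (f x) * twist x (e y) * signOf (g (e y)))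
    _ = ∑ x, ∑ y, signOf (f x) * twist x y * signOf (g y) :=
        sum_congr rfl fun x _ => Equiv.sum_comp e (fun y => signOf (f x) * twist x y * signOf (g y))

/-- `(-1)^{u·v}` for a 4-term inner product is the twist. [folklore] -/
theorem tl_signOf_dot4 (u v : Fin 4 → Bool) :
    signOf ((u 0 && v 0) ^^ (u 1 && v 1) ^^ (u 2 && v 2) ^^ (u 3 && v 3)) =
      twist u v := by
  simp only [signOf_xor, twist, Fin.prod_univ_four]
  rfl

/-- `(-1)^{u·v}` for a 6-term inner product is the twist. [folklore] -/
theorem tl_signOf_dot6 (u v : Fin 6 → Bool) :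
    signOf ((u 0 && v 0) ^^ (u 1 && v 1) ^^ (u 2 && v 2) ^^ (u 3 && v 3) ^^
      (u 4 && v 4) ^^ (u 5 && v 5)) =
      twist u v := by
  simp only [signOf_xor, twist, Fin.prod_univ_six]
  rfl

/-- `(-1)^{u·v}` for a 7-term inner product is the twist. [folklore] -/
theorem tl_signOf_dot7 (u v : Fin 7 → Bool) :
    signOf ((u 0 && v 0) ^^ (u 1 && v 1) ^^ (u 2 && v 2) ^^ (u 3 && v 3) ^^
      (u 4 && v 4) ^^ (u 5 && v 5) ^^ (u 6 && v 6)) =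
      twist u v := by
  simp only [signOf_xor, twist, Fin.prod_univ_seven]
  rfl

/-! ### `n = 8`: `θ₈ ∈ [13/16, 7/8]` -/

/-- **The `𝔽₄`-pencil value at `n = 8`, structurally.** After the coordinate permutation putting the linear block
`y₀,y₁,y₄,y₅` of `g8` first, `(g8, f8)` is a two-sided Maiorana–McFarland pair with quadratic maps `π, τ` of `𝔽₂⁴` and
`τ(π(z)) = z ⊕ [z₀ = z₁ = 0]·(0,0,z₂,z₃)`, so
`Φ(f8, g8) = #{z ∈ 𝔽₂⁴ : (z₀,z₁) ≠ 0 ∨ (z₂,z₃) = 0}/2⁴` (`= 13/16`, `tl8_card`).  (The tree's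
`Negative.SmallCases.forrelation_f8_g8` evaluates the same quantity by `native_decide`.) [this work] -/
theorem tl8_forrelation_eq_card :
    forrelation f8 g8 =
      ((univ.filter fun z : Fin 4 → Bool => (z 0 || z 1 || !(z 2 || z 3)) = true).card : ℝ) / 2 ^ 4 := by
  let σ : Equiv.Perm (Fin (4 + 4)) :=
    ⟨![Fin.castAdd 4 0, Fin.castAdd 4 1, Fin.natAdd 4 0, Fin.natAdd 4 1, Fin.castAdd 4 2, Fin.castAdd 4 3,
       Fin.natAdd 4 2, Fin.natAdd 4 3],
     ![0, 1, 4, 5, 2, 3, 6, 7], by decide, by decide⟩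
  rw [← forrelation_comp_perm σ f8 g8]
  -- sign form of `g8 ∘ σ`: `(-1)^{y′·π(y″)}`
  have hg : ∀ y₁ y₂ : Fin 4 → Bool, signOf (g8 ((Fin.append y₁ y₂) ∘ σ)) =
      twist y₁ ((fun z : Fin 4 → Bool => (![z 0,
          z 1,
          (z 1 && z 3) ^^ (z 1 && z 2) ^^ (z 0 && z 3),
          (z 1 && z 2) ^^ (z 0 && z 3) ^^ (z 0 && z 2)] : Fin 4 → Bool)) y₂) *
      signOf ((fun _ : Fin 4 → Bool => false) y₂) := by
    intro y₁ y₂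
    rw [← tl_signOf_dot4, show signOf ((fun _ : Fin 4 → Bool => false) y₂) = 1 from rfl, mul_one]
    congr 1
    simp only [g8, Function.comp_apply, σ, Equiv.coe_fn_mk, Matrix.cons_val, Fin.append_left, Fin.append_right]
    simp only [show ∀ p q : Bool, (p ^^ q) = p + q from fun _ _ => rfl,
               show ∀ p q : Bool, (p && q) = p * q from fun _ _ => rfl]
    ring
  -- sign form of `f8 ∘ σ`: `(-1)^{x″·τ(x′)}`
  have hf : ∀ x₁ x₂ : Fin 4 → Bool, signOf (f8 ((Fin.append x₁ x₂) ∘ σ)) =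
      twist x₂ ((fun z : Fin 4 → Bool => (![z 0,
          z 1,
          (z 1 && z 3) ^^ (z 0 && z 3) ^^ (z 0 && z 2),
          (z 1 && z 3) ^^ (z 1 && z 2) ^^ (z 0 && z 2)] : Fin 4 → Bool)) x₁) *
      signOf ((fun _ : Fin 4 → Bool => false) x₁) := by
    intro x₁ x₂
    rw [← tl_signOf_dot4, show signOf ((fun _ : Fin 4 → Bool => false) x₁) = 1 from rfl, mul_one]
    congr 1
    simp only [f8, Function.comp_apply, σ, Equiv.coe_fn_mk, Matrix.cons_val, Fin.append_left, Fin.append_right]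
    simp only [show ∀ p q : Bool, (p ^^ q) = p + q from fun _ _ => rfl,
               show ∀ p q : Bool, (p && q) = p * q from fun _ _ => rfl]
    ring
  rw [forrelation_mmPair (m := 4) _ _ _ _ _ _ hg hf]
  simp only [signOf, Bool.false_eq_true, if_false, mul_one]
  rw [sum_boole, div_eq_inv_mul]
  -- both sides count closed predicates over the `2^4` points of `𝔽₂^4`: `#Fix(τ ∘ π)` equals the stated count by evaluation
  congr 3

/-- `#{z ∈ 𝔽₂⁴ : (z₀,z₁) ≠ 0 ∨ (z₂,z₃) = 0} = 16 − 3 = 13`. [folklore] -/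
theorem tl8_card : (univ.filter fun z : Fin 4 → Bool => (z 0 || z 1 || !(z 2 || z 3)) = true).card = 13 := by
  decide

/-- **`θ₈ ∈ [13/16, 7/8]`.**  On `8` bits, isolation of exactness for cubic pairs holds above `7/8` (`isolation_eight`, the
2-adic tower), and no `θ < 13/16` isolates (the `𝔽₄`-pencil pair has `Φ = 13/16 ≠ 1`).  Whether a cubic pair on `8` bits takes a
value in `(13/16, 1)` other than `1` is NOT decided by the tree.  Finite-slice verdict; NOT summit progress. [this work] -/
theorem theta_eight_bounds :
    (∀ f g : (Fin 8 → Bool) → Bool, IsDegLeFun 3 f → IsDegLeFun 3 g →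
        (7 / 8 : ℝ) < forrelation f g → forrelation f g = 1) ∧
    ∀ θ : ℝ, (∀ f g : (Fin 8 → Bool) → Bool, IsDegLeFun 3 f → IsDegLeFun 3 g →
        θ < forrelation f g → forrelation f g = 1) → 13 / 16 ≤ θ := by
  have hval : forrelation f8 g8 = 13 / 16 := by
    rw [tl8_forrelation_eq_card, tl8_card]; norm_num
  refine ⟨fun f g hf hg h => isolation_eight f g hf hg h, fun θ hθ => ?_⟩
  by_contra hlt
  have h1 := hθ f8 g8 isDegLeFun_f8 isDegLeFun_g8 (by rw [hval]; linarith)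
  rw [hval] at h1
  norm_num at h1

/-! ### `n = 12`: `θ₁₂ ∈ [57/64, 15/16]` -/

/-- **The `𝔽₈`-chain value at `n = 12`, structurally.** After the coordinate permutation putting the linear block
`x₀,x₁,x₂,x₉,x₁₀,x₁₁` of `gC` first, `(gC, fC)` is a two-sided Maiorana–McFarland pair with explicit quadratic maps `π, τ` of
`𝔽₂⁶` and `τ(π(z)) = z ⊕ [z₀ = z₁ = z₂ = 0]·(0,0,0,z₃,z₄,z₅)`, so
`Φ(fC, gC) = #{z ∈ 𝔽₂⁶ : (z₀,z₁,z₂) ≠ 0 ∨ (z₃,z₄,z₅) = 0}/2⁶` (`= 57/64`, `tl12_card`).  (The tree's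
`Negative.F8Chain.forrelation_fC_gC` evaluates the same quantity by `native_decide`.) [this work] -/
theorem tl12_forrelation_eq_card :
    forrelation fC gC =
      ((univ.filter fun z : Fin 6 → Bool => (z 0 || z 1 || z 2 || !(z 3 || z 4 || z 5)) = true).card : ℝ) / 2 ^ 6 := by
  let σ : Equiv.Perm (Fin (6 + 6)) :=
    ⟨![Fin.castAdd 6 0, Fin.castAdd 6 1, Fin.castAdd 6 2, Fin.natAdd 6 0, Fin.natAdd 6 1, Fin.natAdd 6 2,
       Fin.natAdd 6 3, Fin.natAdd 6 4, Fin.natAdd 6 5, Fin.castAdd 6 3, Fin.castAdd 6 4, Fin.castAdd 6 5],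
     ![0, 1, 2, 9, 10, 11, 3, 4, 5, 6, 7, 8], by decide, by decide⟩
  rw [← forrelation_comp_perm σ fC gC]
  -- sign form of `gC ∘ σ`: `(-1)^{y′·π(y″)}`
  have hg : ∀ y₁ y₂ : Fin 6 → Bool, signOf (gC ((Fin.append y₁ y₂) ∘ σ)) =
      twist y₁ ((fun z : Fin 6 → Bool => (![z 2 ^^ z 1 ^^ (z 1 && z 2) ^^ z 0,
          z 2 ^^ z 1 ^^ (z 0 && z 2),
          z 2 ^^ (z 0 && z 1),
          (z 2 && z 4) ^^ (z 1 && z 5) ^^ (z 0 && z 3),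
          (z 2 && z 5) ^^ (z 2 && z 3) ^^ (z 1 && z 4) ^^ (z 0 && z 5),
          (z 2 && z 5) ^^ (z 2 && z 4) ^^ (z 1 && z 5) ^^ (z 1 && z 3) ^^ (z 0 && z 4)] : Fin 6 → Bool)) y₂) *
      signOf ((fun _ : Fin 6 → Bool => false) y₂) := by
    intro y₁ y₂
    rw [← tl_signOf_dot6, show signOf ((fun _ : Fin 6 → Bool => false) y₂) = 1 from rfl, mul_one]
    congr 1
    simp only [gC, Function.comp_apply, σ, Equiv.coe_fn_mk, Matrix.cons_val, Fin.append_left, Fin.append_right]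
    simp only [show ∀ p q : Bool, (p ^^ q) = p + q from fun _ _ => rfl,
               show ∀ p q : Bool, (p && q) = p * q from fun _ _ => rfl]
    ring
  -- sign form of `fC ∘ σ`: `(-1)^{x″·τ(x′)}`
  have hf : ∀ x₁ x₂ : Fin 6 → Bool, signOf (fC ((Fin.append x₁ x₂) ∘ σ)) =
      twist x₂ ((fun z : Fin 6 → Bool => (![z 2 ^^ z 1 ^^ (z 1 && z 2) ^^ z 0,
          z 1 ^^ (z 0 && z 2),
          z 2 ^^ z 1 ^^ (z 0 && z 1),
          (z 2 && z 4) ^^ (z 1 && z 5) ^^ (z 0 && z 3),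
          (z 2 && z 4) ^^ (z 2 && z 3) ^^ (z 1 && z 5) ^^ (z 1 && z 4) ^^ (z 0 && z 5),
          (z 2 && z 5) ^^ (z 1 && z 4) ^^ (z 1 && z 3) ^^ (z 0 && z 4)] : Fin 6 → Bool)) x₁) *
      signOf ((fun _ : Fin 6 → Bool => false) x₁) := by
    intro x₁ x₂
    rw [← tl_signOf_dot6, show signOf ((fun _ : Fin 6 → Bool => false) x₁) = 1 from rfl, mul_one]
    congr 1
    simp only [fC, Function.comp_apply, σ, Equiv.coe_fn_mk, Matrix.cons_val, Fin.append_left, Fin.append_right]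
    simp only [show ∀ p q : Bool, (p ^^ q) = p + q from fun _ _ => rfl,
               show ∀ p q : Bool, (p && q) = p * q from fun _ _ => rfl]
    ring
  rw [forrelation_mmPair (m := 6) _ _ _ _ _ _ hg hf]
  simp only [signOf, Bool.false_eq_true, if_false, mul_one]
  rw [sum_boole, div_eq_inv_mul]
  -- both sides count closed predicates over the `2^6` points of `𝔽₂^6`: `#Fix(τ ∘ π)` equals the stated count by evaluation
  congr 3

/-- `#{z ∈ 𝔽₂⁶ : (z₀,z₁,z₂) ≠ 0 ∨ (z₃,z₄,z₅) = 0} = 64 − 7 = 57`. [folklore] -/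
theorem tl12_card :
    (univ.filter fun z : Fin 6 → Bool => (z 0 || z 1 || z 2 || !(z 3 || z 4 || z 5)) = true).card = 57 := by
  decide

/-- **`θ₁₂ ∈ [57/64, 15/16]`.**  On `12` bits, isolation of exactness for cubic pairs holds above `15/16`
(`isolation_twelve_15_16`: 2-adic types + the empty case A), and no `θ < 57/64` isolates (the `𝔽₈`-chain pair has
`Φ = 57/64 ≠ 1`).  The window `(57/64, 15/16]` is NOT decided by the tree.  Finite-slice verdict; NOT summit progress.
[this work] -/
theorem theta_twelve_bounds :
    (∀ f g : (Fin 12 → Bool) → Bool, IsDegLeFun 3 f → IsDegLeFun 3 g →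
        (15 / 16 : ℝ) < forrelation f g → forrelation f g = 1) ∧
    ∀ θ : ℝ, (∀ f g : (Fin 12 → Bool) → Bool, IsDegLeFun 3 f → IsDegLeFun 3 g →
        θ < forrelation f g → forrelation f g = 1) → 57 / 64 ≤ θ := by
  have hval : forrelation fC gC = 57 / 64 := by
    rw [tl12_forrelation_eq_card, tl12_card]; norm_num
  refine ⟨fun f g hf hg h => isolation_twelve_15_16 f g hf hg h, fun θ hθ => ?_⟩
  by_contra hlt
  have h1 := hθ fC gC isDegLeFun_fC isDegLeFun_gC (by rw [hval]; linarith)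
  rw [hval] at h1
  norm_num at h1

/-! ### `n = 14`: `θ₁₄ ∈ [57/64, 31/32]` -/

set_option maxRecDepth 100000 in
/-- **The product value at `n = 14`, structurally.** `(g14, f14) = (gC ⊕ x₁₂x₁₃, fC ⊕ x₁₂x₁₃)`; after the coordinate
permutation putting the linear block `x₀,x₁,x₂,x₉,x₁₀,x₁₁,x₁₂` of `g14` first it is a two-sided Maiorana–McFarland pair on
`7 + 7` bits (`π₆ = τ₆ = id` on the new coordinate), with `τ(π(z)) = z ⊕ [z₀ = z₁ = z₂ = 0]·(0,0,0,z₃,z₄,z₅,0)`, so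
`Φ(f14, g14) = #{z ∈ 𝔽₂⁷ : (z₀,z₁,z₂) ≠ 0 ∨ (z₃,z₄,z₅) = 0}/2⁷` (`= 114/128 = 57/64`, `tl14_card`).  (The tree's
`Negative.ProductFourteen.forrelation_f14_g14` evaluates the same quantity by `native_decide`.) [this work] -/
theorem tl14_forrelation_eq_card :
    forrelation f14 g14 =
      ((univ.filter fun z : Fin 7 → Bool => (z 0 || z 1 || z 2 || !(z 3 || z 4 || z 5)) = true).card : ℝ) / 2 ^ 7 := by
  let σ : Equiv.Perm (Fin (7 + 7)) :=
    ⟨![Fin.castAdd 7 0, Fin.castAdd 7 1, Fin.castAdd 7 2, Fin.natAdd 7 0, Fin.natAdd 7 1, Fin.natAdd 7 2,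
       Fin.natAdd 7 3, Fin.natAdd 7 4, Fin.natAdd 7 5, Fin.castAdd 7 3, Fin.castAdd 7 4, Fin.castAdd 7 5,
       Fin.castAdd 7 6, Fin.natAdd 7 6],
     ![0, 1, 2, 9, 10, 11, 12, 3, 4, 5, 6, 7, 8, 13], by decide, by decide⟩
  rw [← forrelation_comp_perm σ f14 g14]
  -- sign form of `g14 ∘ σ`: `(-1)^{y′·π(y″)}`
  have hg : ∀ y₁ y₂ : Fin 7 → Bool, signOf (g14 ((Fin.append y₁ y₂) ∘ σ)) =
      twist y₁ ((fun z : Fin 7 → Bool => (![z 2 ^^ z 1 ^^ (z 1 && z 2) ^^ z 0,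
          z 2 ^^ z 1 ^^ (z 0 && z 2),
          z 2 ^^ (z 0 && z 1),
          (z 2 && z 4) ^^ (z 1 && z 5) ^^ (z 0 && z 3),
          (z 2 && z 5) ^^ (z 2 && z 3) ^^ (z 1 && z 4) ^^ (z 0 && z 5),
          (z 2 && z 5) ^^ (z 2 && z 4) ^^ (z 1 && z 5) ^^ (z 1 && z 3) ^^ (z 0 && z 4),
          z 6] : Fin 7 → Bool)) y₂) *
      signOf ((fun _ : Fin 7 → Bool => false) y₂) := by
    intro y₁ y₂
    rw [← tl_signOf_dot7, show signOf ((fun _ : Fin 7 → Bool => false) y₂) = 1 from rfl, mul_one]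
    congr 1
    simp only [g14, Function.comp_apply, σ, Equiv.coe_fn_mk, Matrix.cons_val, Fin.append_left, Fin.append_right]
    simp only [show ∀ p q : Bool, (p ^^ q) = p + q from fun _ _ => rfl,
               show ∀ p q : Bool, (p && q) = p * q from fun _ _ => rfl]
    ring
  -- sign form of `f14 ∘ σ`: `(-1)^{x″·τ(x′)}`
  have hf : ∀ x₁ x₂ : Fin 7 → Bool, signOf (f14 ((Fin.append x₁ x₂) ∘ σ)) =
      twist x₂ ((fun z : Fin 7 → Bool => (![z 2 ^^ z 1 ^^ (z 1 && z 2) ^^ z 0,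
          z 1 ^^ (z 0 && z 2),
          z 2 ^^ z 1 ^^ (z 0 && z 1),
          (z 2 && z 4) ^^ (z 1 && z 5) ^^ (z 0 && z 3),
          (z 2 && z 4) ^^ (z 2 && z 3) ^^ (z 1 && z 5) ^^ (z 1 && z 4) ^^ (z 0 && z 5),
          (z 2 && z 5) ^^ (z 1 && z 4) ^^ (z 1 && z 3) ^^ (z 0 && z 4),
          z 6] : Fin 7 → Bool)) x₁) *
      signOf ((fun _ : Fin 7 → Bool => false) x₁) := by
    intro x₁ x₂
    rw [← tl_signOf_dot7, show signOf ((fun _ : Fin 7 → Bool => false) x₁) = 1 from rfl, mul_one]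
    congr 1
    simp only [f14, Function.comp_apply, σ, Equiv.coe_fn_mk, Matrix.cons_val, Fin.append_left, Fin.append_right]
    simp only [show ∀ p q : Bool, (p ^^ q) = p + q from fun _ _ => rfl,
               show ∀ p q : Bool, (p && q) = p * q from fun _ _ => rfl]
    ring
  rw [forrelation_mmPair (m := 7) _ _ _ _ _ _ hg hf]
  simp only [signOf, Bool.false_eq_true, if_false, mul_one]
  rw [sum_boole, div_eq_inv_mul]
  -- both sides count closed predicates over the `2^7` points of `𝔽₂^7`: `#Fix(τ ∘ π)` equals the stated count by evaluation
  congr 3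

set_option maxRecDepth 100000 in
/-- `#{z ∈ 𝔽₂⁷ : (z₀,z₁,z₂) ≠ 0 ∨ (z₃,z₄,z₅) = 0} = 128 − 14 = 114`. [folklore] -/
theorem tl14_card :
    (univ.filter fun z : Fin 7 → Bool => (z 0 || z 1 || z 2 || !(z 3 || z 4 || z 5)) = true).card = 114 := by
  decide

/-- **`θ₁₄ ∈ [57/64, 31/32]`.**  On `14` bits, isolation of exactness for cubic pairs holds above `31/32` (`isolation_fourteen`,
the 2-adic tower), and no `θ < 57/64` isolates (the product pair has `Φ = 57/64 ≠ 1`).  The window `(57/64, 31/32]` is NOT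
decided by the tree.  Finite-slice verdict; NOT summit progress. [this work] -/
theorem theta_fourteen_bounds :
    (∀ f g : (Fin 14 → Bool) → Bool, IsDegLeFun 3 f → IsDegLeFun 3 g →
        (31 / 32 : ℝ) < forrelation f g → forrelation f g = 1) ∧
    ∀ θ : ℝ, (∀ f g : (Fin 14 → Bool) → Bool, IsDegLeFun 3 f → IsDegLeFun 3 g →
        θ < forrelation f g → forrelation f g = 1) → 57 / 64 ≤ θ := by
  have hval : forrelation f14 g14 = 57 / 64 := by
    rw [tl14_forrelation_eq_card, tl14_card]; norm_num
  refine ⟨fun f g hf hg h => isolation_fourteen f g hf hg h, fun θ hθ => ?_⟩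
  by_contra hlt
  have h1 := hθ f14 g14 isDegLeFun_f14 isDegLeFun_g14 (by rw [hval]; linarith)
  rw [hval] at h1
  norm_num at h1

/-! ### `n = 16`: `θ₁₆ ∈ [15/16, 63/64]` -/

/-- **`θ₁₆ ∈ [15/16, 63/64]`.**  On `16` bits, isolation of exactness for cubic pairs holds above `63/64` (`isolation_sixteen`,
the 2-adic tower), and no `θ < 15/16` isolates: the biquadratic Maiorana–McFarland pair of `Negative/FifteenSixteenths.lean` has
`Φ = 15/16 ≠ 1` (`forrelation_f16_g16`, structural).  This is the entry that refutes `7/8` as a GLOBAL constant.  The window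
`(15/16, 63/64]` is NOT decided by the tree.  Finite-slice verdict; NOT summit progress. [this work] -/
theorem theta_sixteen_bounds :
    (∀ f g : (Fin 16 → Bool) → Bool, IsDegLeFun 3 f → IsDegLeFun 3 g →
        (63 / 64 : ℝ) < forrelation f g → forrelation f g = 1) ∧
    ∀ θ : ℝ, (∀ f g : (Fin 16 → Bool) → Bool, IsDegLeFun 3 f → IsDegLeFun 3 g →
        θ < forrelation f g → forrelation f g = 1) → 15 / 16 ≤ θ := by
  refine ⟨fun f g hf hg h => isolation_sixteen f g hf hg h, fun θ hθ => ?_⟩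
  by_contra hlt
  have h1 := hθ f16 g16 isDegLeFun_f16 isDegLeFun_g16 (by rw [forrelation_f16_g16]; linarith)
  rw [forrelation_f16_g16] at h1
  norm_num at h1

end Summit.QuantumAdvantage.QuantumAdvantage.Theorems.CubicForrelation.NearExactIsExact
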